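import Summits.BirchSwinnertonDyer.Rank1Residual.X11b.BDPRouteErratumData
import Summits.BirchSwinnertonDyer.Rank1Residual.X11b.Three.RouteOpenInputsAgree
import Summits.BirchSwinnertonDyer.Rank1Residual.X11b.Three.RouteR1TamagawaSplitOdd
import HarnessLib

/-!
# X11b at `p = 3`, route R1 — the `≥`-HALF of Castella's display (5.3) at `3`, (A≥|VoR)@3, DERIVED from
# a ONE-SIDED Λ-adic shape "(2.4)♭ at the erratum data at `3`" (cell `b2b-bsdres`, team `x11b3`, seat p6; (O-p6-f) = S8♮)

HONEST FRAMING (cell `b2b-bsdres`, run/shared/lean/b2b/bsd-rank1-residual/, verbatim in every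
file): the goal of the cell is to DELETE the COMBINATION-SHAPED residual classes of the
Birch–Swinnerton-Dyer formula for ALL analytic-rank `≤ 1` elliptic curves over `ℚ` — "full BSD
formula for every rank `≤ 1` curve in class `C`" assembled STRICTLY from published theorems — so
that the rank-`≤ 1` remainder becomes exactly the CONSTRUCTION-SHAPED classes, which are TYPED
(missing-input `Prop`s), NOT attempted. This is not "finishing BSD". Team `x11b3` (N8/O2: X11b at
`p = 3`); a RESEARCH ROUTE; no claim beyond the stated class; X11 ∧ `r = 1` at `p = 3` stays
CONSTRUCTION-SHAPED / O2 OPEN; nothing here books anything or changes a label. ONE `Prop`-valued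
SHAPE with a body (OPEN, never a theorem in this cell) and theorems; no named fact; no `sorry`.
Treaty (lead R10-67): multr1-p1's `R1.` / `IsErratumField` infrastructure and multr1-p2's gen-28
`X11b/BDPRouteErratumData.lean` are IMPORTED by name, never restated; x11b3 files nothing at `p ≥ 5`.

## Why

Route R1 at `p = 3` (this seat's `Three/RouteR1*.lean`, S8) reaches `BSD(E,3)` on its population from
published facts and ONE open binder, (A|VoR)@3 = Castella's display (5.3) at `3`; its `≥`-half
(A≥|VoR)@3 = `Display53LowerAt W 3 K P` gives the main-conjecture half, and `BSD(E,3)` on the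
population ∩ {`3 ∤ ∏c`}. multr1-p2 (gen 28, `X11b/BDPRouteErratumData.lean`) DERIVED the `≥`-half at
`p ≥ 5` from a more primitive one-sided shape — a ♭-frame `Q ∈ 𝓞_{ℂ_p}⟦T⟧` with Castella's
interpolation property, the value at `𝟙` and the DIVISIBILITY `Ch_Λ(X_ac^∅)·𝓞_{ℂ_p}⟦T⟧ ⊆ (Q)` at every
erratum datum (`P2.IMCDivIntFrameAtErratumData W p`) — by (CTL≤)ᵗ at the datum (a theorem), multr1-p1's
one-sided ♭-assembly and the link (TAM-q). That shape carries the binder `ErratumHypotheses W p ∋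
(5 ≤ p)`, so at `p = 3` it is VACUOUS; and (TAM-q) was proved for `5 ≤ p` only. This file writes the
`p = 3` twin: the shape with route R1@3's binder list and the same derivation, whose only
`p`-sensitive step (TAM-q) is `Three/RouteR1TamagawaSplitOdd.lean` (every odd `p`).

## What this file proves

* §1 shape **`Three.IMCDivIntFrameAtErratumData₃ W`** — multr1-p2's `P2.IMCDivIntFrameAtErratumData W p`
  body VERBATIM at `p := 3`, the binder `ErratumHypotheses W p → W.analyticRank = 1 →` replaced by
  route R1@3's `IsX11Three W → X11.AprimeLocusAt W 3 →` (the datum binder list of the `hA` of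
  `R1.missingLowerBoundAt_three_of_display53LowerAt`, token for token).
* §2 **`Three.imcLowerWaldspurgerOnTreeAt_three_of_imcDivIntFrameAtErratumData₃`** — route p2's
  pointwise input `(IMC≥∘BDP)ᵗ` at an R1@3 erratum datum from the shape (multr1-p2's §4 proof
  verbatim: (CTL≤)ᵗ@3 = `controlUpperOnTreeAt_of_isErratumField` AT `p = 3`, binders `Mult`/`Irr`).
* §3 **`Three.display53LowerAt_three_of_imcDivIntFrameAtErratumData₃ : … → Display53LowerAt W 3 K P`**.
* §4 end forms — S8's two named-binder theorems with `hA` DISCHARGED from the class-level shape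
  `hD : ∀ W, Three.IMCDivIntFrameAtErratumData₃ W` (+ cited PT/EP; every other binder token for token):
  `Three.R1.missingLowerBoundAt_three_of_imcDivIntFrameAtErratumData₃`,
  `Three.R1.bsdp_three_of_imcDivIntFrameAtErratumData₃_of_not_dvd_tamagawaProduct` (`BSD(E,3)` on
  R1@3 ∩ A1 — the `p = 3` twin of multr1-p2's hybrid record), and the per-curve `…₃_at` through S8♭.

WORDING OF RECORD (lead R10-67, binding): plumbing on route R1@3: (A≥)@3 DERIVED from the (2.4)♭@3
shape + (CTL≤)ᵗ@3 + (TAM-q)@odd p; the shape is OPEN at 3; (A≥|VoR)@3 NOT discharged — the open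
input moves one level down, is not removed; nothing booked. READING after landing (R10-67): R1@3's
one open input printed three ways — (A≥)@3 (S8♯), `P2OpenInputOnTreeOddAt W 3` on the overlap
(S8♭/(O-p6-d)), ⟸ (2.4)♭@3 shape + structural (this file) — none discharged. NO announced derivation
of the shape at `3` ([FW21, Thm. 4.41] is printed for odd `p` on its ordinary branch; its Appendix-B
sourcing at `3` is the team's MI-W3 / barrier B-EW3); every result below is CONDITIONAL on it; NOT a
weakening / restatement of the node `Three.HsiehDescentAt₃`; node / v4.3 / v4.5 / counts UNCHANGED.

References: [Castella2018Erratum] (2.4), Thms. 2.3, 1.1, A′; [Castella2018] Thms. 2.3, 3.1, 3.2, §5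
(5.1)–(5.3) (arXiv:1704.06608 pp. 5, 9, 12); [FouquetWan2021] Thm. 4.41 (PREPRINT); [JetchevSkinnerWan2017]
§7.4.1, §7.3.1; [MilneADT2006] I.4.10(b), I.2.8; [GreenbergLNM1716] Lemma 3.3; [Hsieh2014] p. 7.
-/

noncomputable section

open scoped Classical

open WeierstrassCurve NumberField IsDedekindDomain Field PowerSeries
open Literature.NumberTheory.EllipticCurves Literature.NumberTheory.EllipticCurves.GreenbergSelmer
  Literature.NumberTheory.EllipticCurves.ModularForms Literature.NumberTheory.EllipticCurves.Rank1Residual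
  Literature.NumberTheory.EllipticCurves.Rank1Residual.Typed Literature.NumberTheory.EllipticCurves.Castella2018
  Literature.NumberTheory.GaloisRepresentations Literature.NumberTheory.GaloisCohomology
open Summit.BirchSwinnertonDyer.Rank1Residual.X11b.AcSelmer Summit.BirchSwinnertonDyer.Rank1Residual.X11b.Halves

namespace Summit.BirchSwinnertonDyer.Rank1Residual.X11b.Three

/-! ### §1 The one-sided shape at `p = 3` -/

section Shape

variable (W : WeierstrassCurve ℚ) [W.IsElliptic] [W.IsGloballyMinimal]

/-- **(2.4)♭ ONE-SIDED, WITH VALUE, AT ROUTE R1's ERRATUM DATA AT `p = 3` (OPEN shape)** — the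
`p = 3` twin of multr1-p2's `P2.IMCDivIntFrameAtErratumData W p` (body VERBATIM at `p := 3`; the
binder `ErratumHypotheses W p → W.analyticRank = 1 →`, which contains `5 ≤ p`, replaced by route
R1@3's `IsX11Three W → X11.AprimeLocusAt W 3 →`): at every such datum — `IsX11Three W`, the
A′-locus at `3`, a non-split multiplicative `q ≠ 3` with `3 ∤ v_q(Δ_min)`, an erratum field `K` for
`q` meeting [Cas20, §2.5] at `N_E/3`, a parametrisation datum of level `N_E` with `3 ∤ c` and its
Heegner point `P` of infinite order, an anticyclotomic `κ` with generator `γ`, `ι' : ℚ̄₃ ≅ ℂ` and an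
embedding `e : K → ℚ₃` compatible with `𝔭_{ι'}` — THERE IS
a ♭-frame `(Ω_K ≠ 0, ‖Ω_p‖ = 1, Q ∈ 𝓞_{ℂ₃}⟦T⟧)` with Castella's interpolation property [Cas18 Thm.
3.1, receptacle widened], the value `Q(𝟙) = u·((1 − a₃(E)·3⁻¹)·log_{ω_E} P)²`, `‖u‖ = 1` [Cas18 Thm.
3.2], and the DIVISIBILITY `Ch_Λ(X_ac^∅(E[3^∞]))·𝓞_{ℂ₃}⟦T⟧ ⊆ (Q)` [erratum (2.4)]. OPEN at `3`: NO
source, NO announcement (the erratum's "(2.4) ⇐ [FW21, Thm. 4.41]" is used there at `p ≥ 5`; at `3`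
its sourcing is the team's MI-W3, LINE W). A predicate on `W`; NEVER a theorem in this cell; every
result using it is CONDITIONAL; NOT a cited fact; shape only; nothing asserted.
RELATION to the team's conjecture leaf `Three.IMCDivAt₃ W` (H3, `Three/StepLHalves.lean`): H3 is the
divisibility ALONE, universal over every `R₀⟦T⟧`-frame `L` (`Ω_p ∈ R₀ˣ`), at CLASSICAL Heegner data
(`ClassX11b W 3 ∧ Surj W 3`, every `ℓ ∣ N` split in `K`, `d_K` odd); this shape is frame ∧ value ∧
divisibility for SOME ♭-frame `Q ∈ 𝓞_{ℂ₃}⟦T⟧`, at ERRATUM data (`IsX11Three W`, the ramified prime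
`q ∣ d_K`, no surjectivity). Different frame, different field population: NO implication is claimed
either way, and this is NOT a re-typing of `Three.IMCDivAt₃` (whose `∀`/`∃` shape is untouched).
[cite: Castella2018, Thm. 3.1, display (3.2) and Thm. 3.2 (arXiv:1704.06608 p. 9) (shape only; nothing asserted)]
[cite: Castella2018Erratum, (2.4) (p. 4) (shape only; nothing asserted)]
[cite: Hsieh2014, p. 7 (arXiv:1112.1580) (the receptacle `Z̄_p⟦Γ⁻⟧ ⊆ 𝓞_{ℂ_p}⟦T⟧)] -/
def IMCDivIntFrameAtErratumData₃ : Prop :=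
  ∀ [NeZero (W.conductorNorm ℤ)] (q : ℕ) [Fact q.Prime] (K : Type) [Field K] [NumberField K]
    (Dt : ModularParametrizationData W (W.conductorNorm ℤ))
    (H : HeegnerDatum (W.conductorNorm ℤ) (NumberField.discr K)) (w₀ : InfinitePlace K)
    (P : (W.baseChange K).toAffine.Point), IsX11Three W → X11.AprimeLocusAt W 3 →
    q ≠ 3 → Mult W q → ¬ W.HasSplitMultiplicativeReductionAtPrime q →
    ¬ 3 ∣ padicValInt q W.minimalDiscriminantInt → IsErratumField W K q →
    Cas20Standing K 3 (W.conductorNorm ℤ / 3) →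
    WeierstrassCurve.Affine.Point.map w₀.embedding.toRatAlgHom P = heegnerPointComplex Dt H →
    ¬ (3 : ℤ) ∣ Dt.c → ¬ IsOfFinAddOrder P →
    ∀ (κ : ZpExtension K 3), κ.IsAnticyclotomic →
      ∀ (γ : Field.absoluteGaloisGroup K) [Fact (κ.IsTopGenerator γ)] (ι' : PadicAlgCl 3 ≃+* ℂ)
        (e : K →+* ℚ_[3]),
        (∀ k : 𝓞 K, k ∈ (primeOfEmbeddingDatum 3 ι' w₀.embedding).asIdeal ↔ ‖e (k : K)‖ < 1) →
        ∃ (ΩK : ℂ) (Ωp : ℂ_[3]) (Q : PowerSeries 𝓞_ℂ_[3]), ΩK ≠ 0 ∧ ‖Ωp‖ = 1 ∧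
          R1.IsBDPLFunctionInt 3 ι' (primeOfEmbeddingDatum 3 ι' w₀.embedding) κ γ Dt.f ΩK Ωp Q ∧
          R1.BDPValueAtOneIntAt W 3 e P Q (W.LFunction 3) ∧
          (XAc.charIdeal (W.baseChange K) 3 κ (primeOfEmbeddingDatum 3 ι' w₀.embedding) ∅ γ).map
              (PowerSeries.map (R1.toCpInt 3)) ≤ Ideal.span {Q}

end Shape

/-! ### §2 Route p2's pointwise open input at an R1@3 erratum datum from the shape -/

section Pointwise

variable {W : WeierstrassCurve ℚ} [W.IsElliptic] [W.IsGloballyMinimal]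
  {K : Type} [Field K] [NumberField K]

/-- **Route p2's POINTWISE open input `(IMC≥∘BDP)ᵗ` AT AN R1@3 ERRATUM DATUM from the one-sided
shape at `3`** — multr1-p2's `imcLowerWaldspurgerOnTreeAt_of_imcDivIntFrameAtErratumData` (gen 28)
with `ErratumHypotheses W p` replaced by `IsX11Three W` + `X11.AprimeLocusAt W 3` and its proof
VERBATIM: at an R1@3 erratum datum (`IsX11Three W` on the A′-locus at `3`, non-split multiplicative
`q ≠ 3` with `3 ∤ v_q(Δ_min)`, erratum field `K` for `q` with [Cas20, §2.5] at `N_E/3`, Manin-good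
`Dt`, Heegner point `P` of infinite order through ANY complex embedding `ιK`), for an anticyclotomic
`κ` with generator `γ` and a degree-one `𝔭 ∋ 3`: `IMCLowerWaldspurgerOnTreeAt 3 κ 𝔭 γ (embAt K 3 𝔭) P`,
from `Three.IMCDivIntFrameAtErratumData₃ W`, the one-sided control (CTL≤)ᵗ at the datum
(`controlUpperOnTreeAt_of_isErratumField` at `p = 3`: GZK, modularity, cited PT/EP; `Mult W 3`,
`Irr W 3`) and multr1-p1's one-sided assembly `R1.imcLowerWaldspurgerOnTreeAt_of_intValue_of_intDvd`;
the embedding bookkeeping (`𝔭 = 𝔭_{ι'}`, `ι' ∈ {ι, ι ∘ conj}`; `ord₃ log(τ_* P) = ord₃ log P`) is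
multr1-p1's VERBATIM. CONDITIONAL on the shape (OPEN at `3`); discharges nothing; nothing booked.
[cite: Castella2018, Thms. 2.3, 3.1, 3.2 and §5 (arXiv:1704.06608 pp. 5, 9, 12)] [cite: Castella2018Erratum, (2.4) (p. 4)]
[cite: MilneADT2006, Ch. I, Thm. 4.10(b) and Thm. 2.8] [cite: GreenbergLNM1716, §3 Lemma 3.3 (p. 87)] -/
theorem imcLowerWaldspurgerOnTreeAt_three_of_imcDivIntFrameAtErratumData₃
    (hGZK : rank_eq_analyticRank_of_analyticRank_le_one) (hnf : exists_isNewformOf)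
    (hPT : ∀ (K : Type) [Field K] [NumberField K], poitouTate_sum_localTatePairing_eq_zero K)
    (hEP : ∀ (K : Type) [Field K] [NumberField K] (v : HeightOneSpectrum (𝓞 K)),
      localEulerPoincareCharacteristic (v.adicCompletion K))
    (ι : PadicAlgCl 3 ≃+* ℂ) (hD : IMCDivIntFrameAtErratumData₃ W)
    [NeZero (W.conductorNorm ℤ)] {q : ℕ} [Fact q.Prime]
    (Dt : ModularParametrizationData W (W.conductorNorm ℤ))
    (H : HeegnerDatum (W.conductorNorm ℤ) (NumberField.discr K)) (ιK : K →+* ℂ)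
    {P : (W.baseChange K).toAffine.Point} (hX : IsX11Three W) (hloc : X11.AprimeLocusAt W 3)
    (hq3 : q ≠ 3) (hmq : Mult W q) (hns : ¬ W.HasSplitMultiplicativeReductionAtPrime q)
    (hvq : ¬ 3 ∣ padicValInt q W.minimalDiscriminantInt) (hK : IsErratumField W K q)
    (hCas : Cas20Standing K 3 (W.conductorNorm ℤ / 3))
    (hP : WeierstrassCurve.Affine.Point.map ιK.toRatAlgHom P = heegnerPointComplex Dt H)
    (hc : ¬ (3 : ℤ) ∣ Dt.c) (hinf : ¬ IsOfFinAddOrder P)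
    {κ : ZpExtension K 3} (hκ : κ.IsAnticyclotomic) (γ : Field.absoluteGaloisGroup K)
    [Fact (κ.IsTopGenerator γ)]
    (𝔭 : HeightOneSpectrum (𝓞 K)) (h𝔭 : ((3 : ℕ) : 𝓞 K) ∈ 𝔭.asIdeal)
    (he : 𝔭.asIdeal.ramificationIdx (𝓞 ℚ) = 1) (hf : 𝔭.asIdeal.inertiaDeg (𝓞 ℚ) = 1) :
    IMCLowerWaldspurgerOnTreeAt 3 κ 𝔭 γ (embAt K 3 𝔭 h𝔭 he hf) P := by
  -- the one-sided control at the datum supplies CTL₀ (`Mult W 3`, `Irr W 3` from `IsX11Three`)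
  obtain ⟨n, hn, -⟩ := controlUpperOnTreeAt_of_isErratumField hGZK hnf hPT hEP hX.rank hX.mult
    hX.irr hq3 hK hinf hκ γ 𝔭 h𝔭 he hf
  obtain ⟨w₀⟩ := (inferInstance : Nonempty (InfinitePlace K))
  have hp2 : (3 : ℕ) ≠ 2 := by decide
  -- `rank_ℤ E(K) = 1` on the erratum field (Gross–Zagier–Kolyvagin over `ℚ`)
  have hrk : (W.baseChange K).mordellWeilRank = 1 :=
    (IsErratumField.mordellWeilRank_eq_one_and_shaFinite W hGZK hnf hX.rank hK).1
  -- the datum's complex embedding is `w₀.embedding ∘ τ` for some `τ ∈ Gal(K/ℚ)`, `τ² = 1`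
  haveI : IsGalois ℚ K := by
    haveI : Algebra.IsQuadraticExtension ℚ K := ⟨hK.1.1⟩
    infer_instance
  obtain ⟨σ, hσ⟩ := ComplexEmbedding.exists_comp_symm_eq_of_comp_eq (k := ℚ) w₀.embedding ιK
    (by ext x; simp)
  set τ : K →+* K := ((σ.symm : K ≃ₐ[ℚ] K) : K →+* K) with hτdef
  have hτ : ∀ x, τ (τ x) = x := by
    intro x
    have hcard : Nat.card (K ≃ₐ[ℚ] K) = 2 := by rw [IsGalois.card_aut_eq_finrank, hK.1.1]
    have hsq : σ.symm * σ.symm = 1 := by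
      have h := pow_card_eq_one' (G := K ≃ₐ[ℚ] K) (x := σ.symm)
      rwa [hcard, pow_two] at h
    have := congrArg (fun g : K ≃ₐ[ℚ] K ↦ g x) hsq
    simpa [hτdef, AlgEquiv.mul_apply] using this
  -- the Galois conjugate `P' = τ_* P` is the Heegner point read through `w₀.embedding`
  set P' := WeierstrassCurve.Affine.Point.map τ.toRatAlgHom P with hP'def
  have hP' : WeierstrassCurve.Affine.Point.map w₀.embedding.toRatAlgHom P' =
      heegnerPointComplex Dt H := by
    rw [hP'def, WeierstrassCurve.Affine.Point.map_map]
    have hcomp : w₀.embedding.toRatAlgHom.comp τ.toRatAlgHom = ιK.toRatAlgHom := by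
      apply AlgHom.ext
      intro x
      have := RingHom.congr_fun hσ x
      simpa [hτdef] using this
    rw [hcomp]
    exact hP
  have hinf' : ¬ IsOfFinAddOrder P' := fun h ↦ hinf
    ((WeierstrassCurve.Affine.Point.map_injective (f := τ.toRatAlgHom)).isOfFinAddOrder_iff.mp
      (by simpa [hP'def] using h))
  have hlog : ∀ e : K →+* ℚ_[3], padicLogOrd W 3 e P' = padicLogOrd W 3 e P := fun e ↦
    R1.padicLogOrd_map_eq_of_rank_one W 3 e P hp2 τ hτ hrk hinf
  have hemb : ∀ k : 𝓞 K, k ∈ 𝔭.asIdeal ↔ ‖embAt K 3 𝔭 h𝔭 he hf (k : K)‖ < 1 :=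
    mem_asIdeal_iff_norm_embAt_lt_one 𝔭 h𝔭 he hf
  -- every degree-one prime above `3` is induced by `ι` or by `ι ∘ conj`
  have key : ∀ ι' : PadicAlgCl 3 ≃+* ℂ, 𝔭 = primeOfEmbeddingDatum 3 ι' w₀.embedding →
      IMCLowerWaldspurgerOnTreeAt 3 κ 𝔭 γ (embAt K 3 𝔭 h𝔭 he hf) P := by
    intro ι' h𝔭eq
    subst h𝔭eq
    obtain ⟨ΩK, Ωp, Q, -, -, -, ⟨u, hu, hval⟩, h3At⟩ :=
      hD q K Dt H w₀ P' hX hloc hq3 hmq hns hvq hK hCas hP' hc hinf' κ hκ γ ι' _ hemb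
    refine imcLowerWaldspurgerOnTreeAt_of_padicLogOrd_eq W 3 _ (hlog _) ?_
    exact R1.imcLowerWaldspurgerOnTreeAt_of_intValue_of_intDvd hn h3At (le_of_eq hu)
      (W.LFunction 3) hval
  rcases eq_primeOfEmbeddingDatum_or_eq_trans_starRingAut 3 ι hK.1 w₀ h𝔭 with h | h
  · exact key ι h
  · exact key _ h

/-! ### §3 The `≥`-half (A≥|VoR)@3 at an R1@3 erratum datum from the shape -/

/-- **The `≥`-HALF of Castella's display (5.3) at `3` — (A≥|VoR)@3 = `Display53LowerAt W 3 K P` —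
AT AN R1@3 ERRATUM DATUM from the one-sided shape at `3`** — the `p = 3` twin of multr1-p2's
`display53Lower_of_imcDivIntFrameAtErratumData` (gen 28), same data as §2:
`2·ord₃[E(K):ℤP] − ord₃ ∏_w c_w(E/K) ≤ ord₃ #Ш(E/K)[3^∞]`, from the pointwise input (§2) and the
one-sided control (CTL≤)ᵗ at ONE anticyclotomic `(κ, γ, 𝔭)` (`3` splits in the erratum field:
`3 ∣ N_E`, `3 ≠ q`), both inequalities on `ord₃ f_ac(0)` cancelling
(`two_mul_index_le_of_onTreeUpperLinks`), and (TAM-q) at the odd prime `3`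
(`Three.padicValNat_tamagawaProductSplit_eq_of_isErratumField_odd`). So x11b3's open binder
(A≥|VoR)@3 is, datum by datum, a CONSEQUENCE of (2.4)♭@3. CONDITIONAL on the shape (OPEN at `3`);
one open input moved one level down, NOT removed; discharges nothing; nothing booked.
[cite: Castella2018, §5 (5.1)–(5.3) (arXiv:1704.06608 p. 12)]
[cite: JetchevSkinnerWan2017, §7.4.1 (eq:shalowerK-1) (arXiv:1512.06894 p. 30)] -/
theorem display53LowerAt_three_of_imcDivIntFrameAtErratumData₃
    (hGZK : rank_eq_analyticRank_of_analyticRank_le_one) (hnf : exists_isNewformOf)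
    (hPT : ∀ (K : Type) [Field K] [NumberField K], poitouTate_sum_localTatePairing_eq_zero K)
    (hEP : ∀ (K : Type) [Field K] [NumberField K] (v : HeightOneSpectrum (𝓞 K)),
      localEulerPoincareCharacteristic (v.adicCompletion K))
    (hD : IMCDivIntFrameAtErratumData₃ W)
    [NeZero (W.conductorNorm ℤ)] {q : ℕ} [Fact q.Prime]
    (Dt : ModularParametrizationData W (W.conductorNorm ℤ))
    (H : HeegnerDatum (W.conductorNorm ℤ) (NumberField.discr K)) (ιK : K →+* ℂ)
    {P : (W.baseChange K).toAffine.Point} (hX : IsX11Three W) (hloc : X11.AprimeLocusAt W 3)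
    (hq3 : q ≠ 3) (hmq : Mult W q) (hns : ¬ W.HasSplitMultiplicativeReductionAtPrime q)
    (hvq : ¬ 3 ∣ padicValInt q W.minimalDiscriminantInt) (hK : IsErratumField W K q)
    (hCas : Cas20Standing K 3 (W.conductorNorm ℤ / 3))
    (hP : WeierstrassCurve.Affine.Point.map ιK.toRatAlgHom P = heegnerPointComplex Dt H)
    (hc : ¬ (3 : ℤ) ∣ Dt.c) (hinf : ¬ IsOfFinAddOrder P) :
    Display53LowerAt W 3 K P := by
  obtain ⟨ι⟩ := PadicAlgCl.nonempty_ringEquiv_complex 3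
  have hsplit : SplitsIn K 3 := hK.splitsIn_of_mult hX.mult (Ne.symm hq3)
  obtain ⟨κ, γ, 𝔭, hκ, hγ, h𝔭⟩ := exists_anticyclotomic_generator_prime (p := 3) hK.1
  haveI : Fact (κ.IsTopGenerator γ) := ⟨hγ⟩
  obtain ⟨he, hf⟩ := degreeOne_of_splitsIn hK.1.1 hsplit h𝔭
  have hIW := imcLowerWaldspurgerOnTreeAt_three_of_imcDivIntFrameAtErratumData₃ hGZK hnf hPT hEP ι
    hD Dt H ιK hX hloc hq3 hmq hns hvq hK hCas hP hc hinf hκ γ 𝔭 h𝔭 he hf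
  have hCTL := controlUpperOnTreeAt_of_isErratumField hGZK hnf hPT hEP hX.rank hX.mult hX.irr hq3
    hK hinf hκ γ 𝔭 h𝔭 he hf
  have h := two_mul_index_le_of_onTreeUpperLinks hIW hCTL
  rw [padicValNat_tamagawaProductSplit_eq_of_isErratumField_odd W 3 K (by decide) hmq hvq hK] at h
  unfold Display53LowerAt
  omega

end Pointwise

/-! ### §4 Route R1's `p = 3` end forms with the open binder (A≥|VoR)@3 DISCHARGED from the shape -/

section EndForms

/-- **The main-conjecture half of `BSD(E,3)` on route R1@3's population from (2.4)♭@3** —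
`R1.missingLowerBoundAt_three_of_display53LowerAt` (`Three/RouteR1DisplaySplit.lean`) with its OPEN
binder `hA` = (A≥|VoR)@3 DISCHARGED, datum by datum, by §3 (all other binders token for token):
for `W/ℚ` globally minimal with `IsX11Three W` on the A′ ∧ (ram2)-locus at `3`, an odd non-split
multiplicative `q ≠ 3` with `3 ∤ v_q(Δ_min)` and an erratum field `K` for `q`,
`Typed.MissingLowerBoundAt W 3` from SEVEN published named facts (`hGZ` GZ86 I.7.3, `hGZK`, `hSk`
Skinner 2016 Thm. C (`3 ≤ p` met with equality, for the twist at its multiplicative prime `3`),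
`hnf`, `hCST` CST14 Thm. 1.1, `hMaz`, `hNS`), the cited `hPT` (Milne ADT I.4.10) and `hEP` (I.2.8),
and the ONE OPEN class-level input `hD : ∀ W, Three.IMCDivIntFrameAtErratumData₃ W` (NOT a cited
fact; no announcement at `3`). CONDITIONAL on `hD`; deletes nothing; X11 ∧ `r = 1` at `3` stays
CONSTRUCTION-SHAPED.
[cite: Castella2018, §5 (arXiv:1704.06608 p. 12)] [cite: JetchevSkinnerWan2017, §7.4.1 (eq:shalowerK-1)]
[cite: Castella2018Erratum, (2.4) and Thm. A′ (pp. 1, 4) with "p > 3" read as "p = 3" (shape only; nothing asserted)] -/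
theorem R1.missingLowerBoundAt_three_of_imcDivIntFrameAtErratumData₃
    (hGZ : GrossZagier1986_thm_I_7_3) (hGZK : rank_eq_analyticRank_of_analyticRank_le_one)
    (hSk : Skinner2016.thmC_padicValRat_bsd_rank_zero) (hnf : exists_isNewformOf)
    (hCST : CaiShuTian2014.thm11_trivialChar)
    (hMaz : mazur_not_dvd_maninConstant_of_odd) (hNS : integral_neronScaling_of_isGloballyMinimal)
    (hPT : ∀ (K : Type) [Field K] [NumberField K], poitouTate_sum_localTatePairing_eq_zero K)
    (hEP : ∀ (K : Type) [Field K] [NumberField K] (v : HeightOneSpectrum (𝓞 K)),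
      localEulerPoincareCharacteristic (v.adicCompletion K))
    (hD : ∀ (W : WeierstrassCurve ℚ) [W.IsElliptic] [W.IsGloballyMinimal],
      IMCDivIntFrameAtErratumData₃ W)
    (W : WeierstrassCurve ℚ) [W.IsElliptic] [W.IsGloballyMinimal]
    (hX : IsX11Three W) (hloc : X11.AprimeRam2LocusAt W 3)
    (q : ℕ) [Fact q.Prime] (hq2 : q ≠ 2) (hq3 : q ≠ 3) (hmq : Mult W q)
    (hnsq : ¬ W.HasSplitMultiplicativeReductionAtPrime q)
    (hvq : ¬ 3 ∣ padicValInt q W.minimalDiscriminantInt)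
    (K : Type) [Field K] [NumberField K] (hKf : IsErratumField W K q) :
    Typed.MissingLowerBoundAt W 3 :=
  R1.missingLowerBoundAt_three_of_display53LowerAt hGZ hGZK hSk hnf hCST hMaz hNS
    (fun W _ _ _ _ _ _ _ _ Dt H ι _ hX hl hq3 hmq hns hv hK hS hP hc hnt ↦
      display53LowerAt_three_of_imcDivIntFrameAtErratumData₃ hGZK hnf hPT hEP (hD W) Dt H ι hX hl
        hq3 hmq hns hv hK hS hP hc hnt)
    W hX hloc q hq2 hq3 hmq hnsq hvq K hKf

/-- **`BSD(E,3)` on route R1@3's population ∩ {`3 ∤ ∏_ℓ c_ℓ(E)`} from (2.4)♭@3 — the `p = 3` twin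
of multr1-p2's hybrid record `P2.bsdp_of_r1Population_of_not_dvd_of_imcDivIntFrameAtErratumData`.**
`R1.bsdp_three_of_display53LowerAt_of_not_dvd_tamagawaProduct` (`Three/RouteR1DisplaySplit.lean`)
with its OPEN binder `hA` = (A≥|VoR)@3 DISCHARGED from the class-level shape `hD` (all other
binders token for token): UPPER half = multr1-p2's Kolyvagin theorem at a classical Heegner field
(`IsX11Three.missingUpperBoundAt_of_ram_of_not_dvd`; `hGZ hKo hB hSk hGZK hmod hnf hHL hMaz hNS`),
LOWER half = route R1 at `3` (`hGZ1 hCST hFH` + the above) fed by §3 (+ cited `hPT hEP`). So on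
R1@3's population ∩ A1 the kernel asks of the literature — beyond PUBLISHED theorems and the cited
PT/EP — EXACTLY the one-sided shape (2.4)♭@3 at the erratum data, nothing per pair. CONDITIONAL on
`hD` (OPEN at `3`); deletes nothing; X11 ∧ `r = 1` at `3` stays CONSTRUCTION-SHAPED; nothing booked.
[cite: McCallumLMS1991, §1 Theorem (Kolyvagin), p. 296] [cite: Castella2018, §5 (arXiv:1704.06608 p. 12)]
[cite: JetchevSkinnerWan2017, §7.4.1 (eq:shalowerK-1)] [cite: Miller2011LMS, Def. 1.1] -/
theorem R1.bsdp_three_of_imcDivIntFrameAtErratumData₃_of_not_dvd_tamagawaProduct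
    (hGZ : ∀ (N : ℕ) [NeZero N] (W : WeierstrassCurve ℚ) (K : Type) [Field K] [NumberField K],
      gross_zagier N W K)
    (hKo : ∀ (N : ℕ) [NeZero N] (W : WeierstrassCurve ℚ) (K : Type) [Field K] [NumberField K],
      kolyvagin N W K)
    (hB : ∀ (N : ℕ) [NeZero N] (W : WeierstrassCurve ℚ) (K : Type) [Field K] [NumberField K],
      Kolyvagin1990_padicValNat_card_sha_le N W K)
    (hSk : Skinner2016.thmC_padicValRat_bsd_rank_zero)
    (hGZK : rank_eq_analyticRank_of_analyticRank_le_one) (hmod : hasEntireLFunction_rat)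
    (hnf : exists_isNewformOf) (hHL : HoffsteinLuo1997_exists_twist_L_one_ne_zero)
    (hMaz : mazur_not_dvd_maninConstant_of_odd) (hNS : integral_neronScaling_of_isGloballyMinimal)
    (hGZ1 : GrossZagier1986_thm_I_7_3) (hCST : CaiShuTian2014.thm11_trivialChar)
    (hFH : friedbergHoffstein_exists_twist_ne_zero_ramifiedAt)
    (hPT : ∀ (K : Type) [Field K] [NumberField K], poitouTate_sum_localTatePairing_eq_zero K)
    (hEP : ∀ (K : Type) [Field K] [NumberField K] (v : HeightOneSpectrum (𝓞 K)),
      localEulerPoincareCharacteristic (v.adicCompletion K))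
    (hD : ∀ (W : WeierstrassCurve ℚ) [W.IsElliptic] [W.IsGloballyMinimal],
      IMCDivIntFrameAtErratumData₃ W)
    (W : WeierstrassCurve ℚ) [W.IsElliptic] [W.IsGloballyMinimal]
    (hX : IsX11Three W) (hloc : X11.AprimeRam2LocusAt W 3)
    (hq : ∃ (q : ℕ) (_ : Fact q.Prime), q ≠ 2 ∧ q ≠ 3 ∧ Mult W q ∧
      ¬ W.HasSplitMultiplicativeReductionAtPrime q ∧ ¬ 3 ∣ padicValInt q W.minimalDiscriminantInt)
    (htam : ¬ 3 ∣ W.tamagawaProduct) : BSDp W 3 :=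
  R1.bsdp_three_of_display53LowerAt_of_not_dvd_tamagawaProduct hGZ hKo hB hSk hGZK hmod hnf hHL hMaz
    hNS hGZ1 hCST hFH
    (fun W _ _ _ _ _ _ _ _ Dt H ι _ hX hl hq3 hmq hns hv hK hS hP hc hnt ↦
      display53LowerAt_three_of_imcDivIntFrameAtErratumData₃ hGZK hnf hPT hEP (hD W) Dt H ι hX hl
        hq3 hmq hns hv hK hS hP hc hnt)
    W hX hloc hq htam

/-- **`BSD(E,3)` for ONE curve at ONE R1@3 datum with `3 ∤ ∏_ℓ c_ℓ(E)`, from the one-sided shape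
for THIS curve** — S8♭ (`R1.bsdp_three_of_display53LowerAt_at`) with its per-datum input
`Display53LowerAt W 3 K P` SUPPLIED by §3 from `hD : Three.IMCDivIntFrameAtErratumData₃ W` ([Cas20,
§2.5] at `N_E/3` by `cas20Standing_of_isErratumField_odd`). TEN published named-fact binders + cited
`hPT hEP` + the OPEN shape for this `W`; discharges nothing; nothing booked.
[cite: Castella2018, §5 (arXiv:1704.06608 p. 12)] [cite: JetchevSkinnerWan2017, §7.4.1 (eq:shalowerK-1)]
[cite: McCallumLMS1991, §1 Theorem (Kolyvagin), p. 296] [cite: Miller2011LMS, Def. 1.1] -/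
theorem R1.bsdp_three_of_imcDivIntFrameAtErratumData₃_at
    (hGZ : ∀ (N : ℕ) [NeZero N] (W : WeierstrassCurve ℚ) (K : Type) [Field K] [NumberField K],
      gross_zagier N W K)
    (hKo : ∀ (N : ℕ) [NeZero N] (W : WeierstrassCurve ℚ) (K : Type) [Field K] [NumberField K],
      kolyvagin N W K)
    (hB : ∀ (N : ℕ) [NeZero N] (W : WeierstrassCurve ℚ) (K : Type) [Field K] [NumberField K],
      Kolyvagin1990_padicValNat_card_sha_le N W K)
    (hSk : Skinner2016.thmC_padicValRat_bsd_rank_zero)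
    (hGZK : rank_eq_analyticRank_of_analyticRank_le_one) (hnf : exists_isNewformOf)
    (hHL : HoffsteinLuo1997_exists_twist_L_one_ne_zero) (hMaz : mazur_not_dvd_maninConstant_of_odd)
    (hGZ1 : GrossZagier1986_thm_I_7_3) (hCST : CaiShuTian2014.thm11_trivialChar)
    (hPT : ∀ (K : Type) [Field K] [NumberField K], poitouTate_sum_localTatePairing_eq_zero K)
    (hEP : ∀ (K : Type) [Field K] [NumberField K] (v : HeightOneSpectrum (𝓞 K)),
      localEulerPoincareCharacteristic (v.adicCompletion K))
    (W : WeierstrassCurve ℚ) [W.IsElliptic] [W.IsGloballyMinimal] [NeZero (W.conductorNorm ℤ)]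
    (hD : IMCDivIntFrameAtErratumData₃ W)
    (hX : IsX11Three W) (hloc : X11.AprimeRam2LocusAt W 3)
    (q : ℕ) [Fact q.Prime] (hq2 : q ≠ 2) (hq3 : q ≠ 3) (hmq : Mult W q)
    (hnsq : ¬ W.HasSplitMultiplicativeReductionAtPrime q)
    (hvq : ¬ 3 ∣ padicValInt q W.minimalDiscriminantInt)
    (K : Type) [Field K] [NumberField K] (hKf : IsErratumField W K q)
    (Dt : ModularParametrizationData W (W.conductorNorm ℤ))
    (H : HeegnerDatum (W.conductorNorm ℤ) (NumberField.discr K)) (ι : K →+* ℂ)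
    (P : (W.baseChange K).toAffine.Point)
    (hP : WeierstrassCurve.Affine.Point.map ι.toRatAlgHom P = heegnerPointComplex Dt H)
    (hc : ¬ (3 : ℤ) ∣ Dt.c) (hnt : ¬ IsOfFinAddOrder P) (htam : ¬ 3 ∣ W.tamagawaProduct) :
    BSDp W 3 :=
  R1.bsdp_three_of_display53LowerAt_at W hGZ hKo hB hSk hGZK hnf hHL hMaz hGZ1 hCST hX hloc q hq2 hq3
    hmq hnsq hvq K hKf Dt H ι P hP hc hnt htam
    (display53LowerAt_three_of_imcDivIntFrameAtErratumData₃ hGZK hnf hPT hEP hD Dt H ι hX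
      (X11.aprimeLocusAt_of_aprimeRam2LocusAt hloc) hq3 hmq hnsq hvq hKf
      (cas20Standing_of_isErratumField_odd W 3 (by decide) hX.mult hq3 hq2 hmq hKf) hP hc hnt)

end EndForms

end Summit.BirchSwinnertonDyer.Rank1Residual.X11b.Three

end
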